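/-
Copyright (c) 2026 the pub-hodgecm-mathlib formalisation cell (harness21).  Prover seat hodgecm-mathlib-K2E1-p08 (g2), Track B ∕ K2-LIT
(build stream 29), h413 = `stmt-HodgeConjecture-24833`, line `K2_E1_TraceFormulaBeta`; BY-NAME DEAL #6 of the dealer K2E1-plan (g0)
2026-09-03T23:36:04Z: `Theorems/K2E1XiHPinnedOffSplitPlaces.lean` (the ROW-14 ASSEMBLY NODE: first consumer BY SHAPE of the live socket 14L `sig_K2E1EvpSeparatesSplitPlaces`).
-/
import Summits.HodgeConjecture.HodgeConjecture.Theorems.K2E1EvpTransferXiH          -- ★ p855449: `psiG`, `bOp`, `IsXiHDual`, `evp_lift_eq_psiG_evp` (+ ★ p855362 `evp`, `classSphericalCharacter`)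
import Summits.HodgeConjecture.HodgeConjecture.Theorems.K2E1EvpOfAutomorphicClass    -- ★ p855414: `evpAtIntegralLevel`, `evpOfClass_apply_eq_evp`
import Summits.HodgeConjecture.HodgeConjecture.Theorems.F0P3GlobalPacketDiscrete      -- ★ `cmOccursInDiscreteSpectrum`
import HarnessLib

/-!
# K2·E1 — ROW-14 ASSEMBLY NODE `K2E1XiHPinnedOffSplitPlaces`: «the `G`-side e.v.p. PINS the `H`-side datum `ξ` at the SPLIT places off `S`» — from the live socket 14L
# `sig_K2E1EvpSeparatesSplitPlaces` (consumed BY SHAPE), the transfer law `t(lift ∘ ξ) = ψ_G(t(ξ))` (★ p855449) and ONE named binder, the injectivity of the local lift at split places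

Track B ∕ K2-LIT, crux h413 = `stmt-HodgeConjecture-24833`, route of record `HCCMUnconditional`; cell `hodgecm-mathlib`, squad K2; prover seat
`hodgecm-mathlib-K2E1-p08` (g2), BY-NAME DEAL #6 of the dealer K2E1-plan (g0) 2026-09-03T23:36:04Z; lane `--supports stmt-HodgeConjecture-24833 --as helper` (count-neutral).
THEOREMS ONLY (no `def`, no `instance`, no notation, no named-fact `def`, no `sorry`).  A `Theorems/` file cannot import `Cruxes/…/Lines`, so the socket 14L is taken as the
HYPOTHESIS `h14L` whose type is the statement of `sig_K2E1EvpSeparatesSplitPlaces` (Sigs ED. 10 :322) BYTE FOR BYTE; the first consumer of 14L by shape.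

THE MATHEMATICS [Rogawski1990 §13.6 p. 209 («a map `ψ` of L-groups defines a transfer `t → ψ(t)` of e.v.p.'s»), §13.8 p. 218 («the sum over `π` with `ψ_G(t(π)) = t`»,
(ii) «`ρ_v` unramified for finite `v ≠ w`»), Thm. 13.3.5 p. 202 (split places: packets are singletons, local base change `π_v ⊗ π_v^θ`), §13.5 pp. 204–206; JacquetShalika1981 Thm. 4.4].
Frame: CM `L`, `H ∈ M₃(L)` hermitian non-degenerate, `μ` automorphic on `U(H)`, a finite set `S` of finite places of `L⁺`; on the `G`-side the CONCRETE currency of 14L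
(`G_v = (cmDatum L 3 H).Local v`, level `U(H)(𝒪_v)` = ★ `cmLocalIntegralLevel`, ★ `cmOccursInDiscreteSpectrum`, ★ p855414 `evpAtIntegralLevel`); on the `H`-side the GENERIC data of
★ p855449 (local groups `GH v`, levels `KH v`, the class-level LIFT `lift v : Irr(H_v) → Irr(G_v)` and the dual Hecke maps `b_v : ℋ(G_v, U(H)(𝒪_v)) → ℋ(H_v, K_{H,v})` with their
defining trace identity ★ `IsXiHDual`).  Then:
1. `IsXiHDual` ⇒ `t(lift ∘ ξ) = ψ_G(t(ξ))` (★ `evp_lift_eq_psiG_evp`, `ᵐᵒᵖ`-currency) read in the un-opped currency of 14L (★ `evpOfClass_apply_eq_evp`): two `H`-families `ξ, ξ′` with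
   the SAME TRANSFERRED package `ψ_G(t(ξ)) = ψ_G(t(ξ′))` (weaker than `t(ξ) = t(ξ′)`) have lifts with equal integral-level e.v.p.'s (`evpAtIntegralLevel_lift_eq_of_psiG_evp_eq`);
2. if both lifted families OCCUR in `L²_disc(U(H))`, 14L gives `lift(ξ_v) = lift(ξ′_v)` at EVERY SPLIT place (`lift_eq_at_split_of_psiG_evp_eq`);
3. with the ONE NAMED BINDER `hLiftInj` — «at a split `v ∉ S` the local lift is injective on the `K_{H,v}`-spherical classes» — `ξ_v = ξ′_v` at every split `v ∉ S`
   (`xi_eq_at_split_of_psiG_evp_eq`): «the transferred e.v.p. determines `ξ` off `S` at the split places»;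
4. the same with a `G`-side `π` explicit: an OCCURRING `π` with `t(π) = ψ_G(t(ξ))` equals `lift ∘ ξ` at the split places when `lift ∘ ξ` occurs (`eq_lift_at_split_of_evp_eq_psiG`),
   hence «`π` determines `ξ` off `S` at split places» for two such `ξ, ξ′` (`xi_eq_at_split_of_evp_eq_psiG`) — the `H`-side PIN used by (f) `FlathHHyp` ∕ «`ρ_v = St_H(ξ_v)`» of
   ★ `K2E1St1383LetterOfPinned1383` [Rogawski1990 Thm. 13.3.5 (c)-shape].
ON THE BINDER `hLiftInj` (honesty note).  ★ holds no injectivity of a local lift (★ `psiGInjective` ∕ `TwistedComparisonData.HatInjective` are GLOBAL e.v.p.-level shells on posited carriers),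
and the blanket local statement is FALSE for general unramified classes at a split place (`H_v ≅ GL₂ × GL₁`, `G_v ≅ GL₃`: the Satake multiset `{χ₁μ, χ₂μ, χ₃μ′}` forgets the
`(2,1)`-partition).  It is therefore a hypothesis on the ABSTRACT parameter `lift` of ★ p855449 restricted to the `K_{H,v}`-spherical classes at split `v ∉ S`, to be met by the
route's actual class of `ξ`'s (characters ∕ `St_H(ξ)`), never asserted here.

HONEST LABEL: HC_CM is proved only modulo the 7 printed citations (2 remaining named inputs: hLiu418 = `stmt-HodgeConjecture-24832`, h413 = `stmt-HodgeConjecture-24833`)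
until rung 0 closes; this node moves no counter and closes no socket (14L stays LIVE; it is consumed, not paid).

## References
* [Rogawski1990] J. D. Rogawski, *Automorphic Representations of Unitary Groups in Three Variables*, Ann. of Math. Stud. 123 (1990), §13.3 Thm. 13.3.5 p. 202, §13.5
  pp. 204–206, §13.6 p. 209, §13.8 p. 218.
* [JacquetShalika1981] H. Jacquet, J. Shalika, *On Euler products and the classification of automorphic forms* II, Amer. J. Math. 103 (1981), Thm. 4.4.
* [CartierCorvallis1979] P. Cartier, *Representations of 𝔭-adic groups: a survey*, PSPM 33.1 (1979), §IV.1 Cor. 4.1–4.2.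
-/

set_option autoImplicit false
-- the mandated namespace repeats the single-problem summit's segment (`HodgeConjecture.HodgeConjecture`)
set_option linter.dupNamespace false

noncomputable section

open NumberField IsDedekindDomain MeasureTheory Filter
open scoped Matrix MatrixGroups
open Literature.NumberTheory.Rogawski1990 Literature.NumberTheory.Automorphic Literature.NumberTheory.Automorphic.UnitaryGroup
open Literature.NumberTheory.GaloisRepresentations
open Summit.HodgeConjecture.HodgeConjecture.Cruxes.H413.F0P3GlobalPacketDiscrete (cmOccursInDiscreteSpectrum)
open Summit.HodgeConjecture.HodgeConjecture.Cruxes.H413.K2E1EigenvaluePackageOfSpherical (evp)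
open Summit.HodgeConjecture.HodgeConjecture.Cruxes.H413.K2E1EvpOfAutomorphicClass (evpAtIntegralLevel evpOfClass_apply_eq_evp)
open Summit.HodgeConjecture.HodgeConjecture.Cruxes.H413.K2E1EvpTransferXiH (psiG bOp IsXiHDual evp_lift_eq_psiG_evp)

namespace Summit.HodgeConjecture.HodgeConjecture.Cruxes.H413.K2E1XiHPinnedOffSplitPlaces

variable (L : Type) [Field L] [NumberField L] [IsCMField L] (H : Matrix (Fin 3) (Fin 3) L)
  (hH : (H.map (cmConjRingHom L))ᵀ = H) (hHd : IsUnit H.det)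
  (μ : Measure (adelicGroupData (↥(maximalRealSubfield L)) L (IsCMField.complexConj L) 3 H).automorphicQuotient)
  [(adelicGroupData (↥(maximalRealSubfield L)) L (IsCMField.complexConj L) 3 H).IsAutomorphicMeasure μ]
  {S : Set (HeightOneSpectrum (𝓞 ↥(maximalRealSubfield L)))} (hS : S.Finite)
  {GH : HeightOneSpectrum (𝓞 ↥(maximalRealSubfield L)) → Type} [∀ v, Group (GH v)] [∀ v, TopologicalSpace (GH v)]
  (KH : ∀ v, Subgroup (GH v))
  (lift : ∀ v, IrrClass (GH v) → IrrClass ((cmDatum L 3 H).Local v))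
  (b : ∀ v : {v : HeightOneSpectrum (𝓞 ↥(maximalRealSubfield L)) // v ∉ S},
    heckeAlgebra ℂ ((cmDatum L 3 H).Local v.1) (cmLocalIntegralLevel L 3 H v.1) →ₐ[ℂ] heckeAlgebra ℂ (GH v.1) (KH v.1))

/-! ## §1 `ψ_G(t(ξ)) = ψ_G(t(ξ′))` ⇒ the lifted families have the same integral-level e.v.p. -/

/-- **Equal transferred packages ⇒ equal e.v.p.'s of the lifts.**  Under ★ `IsXiHDual` (the dual maps `b_v` are compatible with the class-level lift), two `H`-families `ξ, ξ′`,
`K_{H,v}`-spherical off `S` with `U(H)(𝒪_v)`-spherical lifts, whose TRANSFERRED eigenvalue packages agree — `ψ_G(t(ξ)) = ψ_G(t(ξ′))` in ★ p855362's `ᵐᵒᵖ`-currency (weaker than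
`t(ξ) = t(ξ′)`: apply `congrArg (psiG (bOp b))`) — have lifts with the SAME integral-level e.v.p. of ★ p855414 (the currency of 14L): ★ `evp_lift_eq_psiG_evp` on both sides, un-opped by
★ `evpOfClass_apply_eq_evp`. [cite: Rogawski1990, §13.6 p. 209] [cite: Rogawski1990, §13.8 p. 218] -/
theorem evpAtIntegralLevel_lift_eq_of_psiG_evp_eq
    (hdual : IsXiHDual (fun v => (cmDatum L 3 H).Local v) GH (fun v => cmLocalIntegralLevel L 3 H v) KH lift b)
    (ξ ξ' : ∀ v, IrrClass (GH v)) (hξ : ∀ v, v ∉ S → (ξ v).IsSpherical (KH v)) (hξ' : ∀ v, v ∉ S → (ξ' v).IsSpherical (KH v))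
    (hl : ∀ v, v ∉ S → (lift v (ξ v)).IsSpherical (cmLocalIntegralLevel L 3 H v)) (hl' : ∀ v, v ∉ S → (lift v (ξ' v)).IsSpherical (cmLocalIntegralLevel L 3 H v))
    (ht : psiG (𝓗G := fun v => (heckeAlgebra ℂ ((cmDatum L 3 H).Local v) (cmLocalIntegralLevel L 3 H v))ᵐᵒᵖ) (bOp b) (evp GH KH ξ S hξ) = psiG (𝓗G := fun v => (heckeAlgebra ℂ ((cmDatum L 3 H).Local v) (cmLocalIntegralLevel L 3 H v))ᵐᵒᵖ) (bOp b) (evp GH KH ξ' S hξ')) :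
    evpAtIntegralLevel L 3 H (fun v => lift v (ξ v)) S hl = evpAtIntegralLevel L 3 H (fun v => lift v (ξ' v)) S hl' := by
  have h1 := evp_lift_eq_psiG_evp hdual ξ hξ hl
  have h2 := evp_lift_eq_psiG_evp hdual ξ' hξ' hl'
  funext v
  apply AlgHom.ext
  intro T
  rw [evpAtIntegralLevel, evpAtIntegralLevel, evpOfClass_apply_eq_evp, evpOfClass_apply_eq_evp, h1, h2, ht]

/-! ## §2 + 14L: the lifts agree at every split place; + injectivity of the local lift: `ξ_v = ξ′_v` at split `v ∉ S` -/

include hH hHd hS in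
/-- **THE LIFTS AGREE AT THE SPLIT PLACES.**  Hypotheses of §1, both lifted families OCCURRING in `L²_disc(U(H))` (★ `cmOccursInDiscreteSpectrum`), and the live socket 14L
`sig_K2E1EvpSeparatesSplitPlaces` as the hypothesis `h14L` (its statement VERBATIM): then `lift(ξ_v) = lift(ξ′_v)` at EVERY place `v` of `L⁺` split in `L`.
[cite: Rogawski1990, Thm. 13.3.5 p. 202 and §13.6 p. 208] [cite: JacquetShalika1981, Thm. 4.4] -/
theorem lift_eq_at_split_of_psiG_evp_eq
    (h14L : ∀ (L : Type) [Field L] [NumberField L] [IsCMField L] (H : Matrix (Fin 3) (Fin 3) L)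
      (_hH : (H.map (cmConjRingHom L))ᵀ = H) (_hHd : IsUnit H.det)
      (μ : Measure (adelicGroupData (↥(maximalRealSubfield L)) L (IsCMField.complexConj L) 3 H).automorphicQuotient)
      [(adelicGroupData (↥(maximalRealSubfield L)) L (IsCMField.complexConj L) 3 H).IsAutomorphicMeasure μ]
      (S : Set (HeightOneSpectrum (𝓞 ↥(maximalRealSubfield L)))), S.Finite →
      ∀ (π π' : ∀ v : HeightOneSpectrum (𝓞 ↥(maximalRealSubfield L)), IrrClass ((cmDatum L 3 H).Local v))
        (hπ : ∀ v, v ∉ S → (π v).IsSpherical (cmLocalIntegralLevel L 3 H v))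
        (hπ' : ∀ v, v ∉ S → (π' v).IsSpherical (cmLocalIntegralLevel L 3 H v)),
        cmOccursInDiscreteSpectrum L 3 H μ π → cmOccursInDiscreteSpectrum L 3 H μ π' →
        K2E1EvpOfAutomorphicClass.evpAtIntegralLevel L 3 H π S hπ = K2E1EvpOfAutomorphicClass.evpAtIntegralLevel L 3 H π' S hπ' →
        ∀ v : HeightOneSpectrum (𝓞 ↥(maximalRealSubfield L)), (∃ w : PlacesOver L v, IsCMField.complexConj L • w.1 ≠ w.1) → π v = π' v)
    (hdual : IsXiHDual (fun v => (cmDatum L 3 H).Local v) GH (fun v => cmLocalIntegralLevel L 3 H v) KH lift b)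
    (ξ ξ' : ∀ v, IrrClass (GH v)) (hξ : ∀ v, v ∉ S → (ξ v).IsSpherical (KH v)) (hξ' : ∀ v, v ∉ S → (ξ' v).IsSpherical (KH v))
    (hl : ∀ v, v ∉ S → (lift v (ξ v)).IsSpherical (cmLocalIntegralLevel L 3 H v)) (hl' : ∀ v, v ∉ S → (lift v (ξ' v)).IsSpherical (cmLocalIntegralLevel L 3 H v))
    (hocc : cmOccursInDiscreteSpectrum L 3 H μ fun v => lift v (ξ v)) (hocc' : cmOccursInDiscreteSpectrum L 3 H μ fun v => lift v (ξ' v))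
    (ht : psiG (𝓗G := fun v => (heckeAlgebra ℂ ((cmDatum L 3 H).Local v) (cmLocalIntegralLevel L 3 H v))ᵐᵒᵖ) (bOp b) (evp GH KH ξ S hξ) = psiG (𝓗G := fun v => (heckeAlgebra ℂ ((cmDatum L 3 H).Local v) (cmLocalIntegralLevel L 3 H v))ᵐᵒᵖ) (bOp b) (evp GH KH ξ' S hξ'))
    (v : HeightOneSpectrum (𝓞 ↥(maximalRealSubfield L))) (hv : ∃ w : PlacesOver L v, IsCMField.complexConj L • w.1 ≠ w.1) :
    lift v (ξ v) = lift v (ξ' v) :=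
  h14L L H hH hHd μ S hS (fun v => lift v (ξ v)) (fun v => lift v (ξ' v)) hl hl' hocc hocc'
    (evpAtIntegralLevel_lift_eq_of_psiG_evp_eq L H KH lift b hdual ξ ξ' hξ hξ' hl hl' ht) v hv

include hH hHd hS in
/-- **«THE TRANSFERRED E.V.P. DETERMINES `ξ` OFF `S` AT THE SPLIT PLACES».**  Hypotheses of `lift_eq_at_split_of_psiG_evp_eq` and ONE NAMED BINDER `hLiftInj`: at every split
`v ∉ S` the local lift `Irr(H_v) → Irr(G_v)` is INJECTIVE ON THE `K_{H,v}`-SPHERICAL CLASSES (a hypothesis on the abstract parameter `lift` of ★ p855449; see the module docstring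
for why it is not asserted).  Then `ξ_v = ξ′_v` at every split `v ∉ S`. [cite: Rogawski1990, Thm. 13.3.5 p. 202 and §13.5 pp. 204–206] [cite: Rogawski1990, §13.8 p. 218] -/
theorem xi_eq_at_split_of_psiG_evp_eq
    (h14L : ∀ (L : Type) [Field L] [NumberField L] [IsCMField L] (H : Matrix (Fin 3) (Fin 3) L)
      (_hH : (H.map (cmConjRingHom L))ᵀ = H) (_hHd : IsUnit H.det)
      (μ : Measure (adelicGroupData (↥(maximalRealSubfield L)) L (IsCMField.complexConj L) 3 H).automorphicQuotient)
      [(adelicGroupData (↥(maximalRealSubfield L)) L (IsCMField.complexConj L) 3 H).IsAutomorphicMeasure μ]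
      (S : Set (HeightOneSpectrum (𝓞 ↥(maximalRealSubfield L)))), S.Finite →
      ∀ (π π' : ∀ v : HeightOneSpectrum (𝓞 ↥(maximalRealSubfield L)), IrrClass ((cmDatum L 3 H).Local v))
        (hπ : ∀ v, v ∉ S → (π v).IsSpherical (cmLocalIntegralLevel L 3 H v))
        (hπ' : ∀ v, v ∉ S → (π' v).IsSpherical (cmLocalIntegralLevel L 3 H v)),
        cmOccursInDiscreteSpectrum L 3 H μ π → cmOccursInDiscreteSpectrum L 3 H μ π' →
        K2E1EvpOfAutomorphicClass.evpAtIntegralLevel L 3 H π S hπ = K2E1EvpOfAutomorphicClass.evpAtIntegralLevel L 3 H π' S hπ' →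
        ∀ v : HeightOneSpectrum (𝓞 ↥(maximalRealSubfield L)), (∃ w : PlacesOver L v, IsCMField.complexConj L • w.1 ≠ w.1) → π v = π' v)
    (hLiftInj : ∀ v, v ∉ S → (∃ w : PlacesOver L v, IsCMField.complexConj L • w.1 ≠ w.1) →
      ∀ ρ₁ ρ₂ : IrrClass (GH v), ρ₁.IsSpherical (KH v) → ρ₂.IsSpherical (KH v) → lift v ρ₁ = lift v ρ₂ → ρ₁ = ρ₂)
    (hdual : IsXiHDual (fun v => (cmDatum L 3 H).Local v) GH (fun v => cmLocalIntegralLevel L 3 H v) KH lift b)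
    (ξ ξ' : ∀ v, IrrClass (GH v)) (hξ : ∀ v, v ∉ S → (ξ v).IsSpherical (KH v)) (hξ' : ∀ v, v ∉ S → (ξ' v).IsSpherical (KH v))
    (hl : ∀ v, v ∉ S → (lift v (ξ v)).IsSpherical (cmLocalIntegralLevel L 3 H v)) (hl' : ∀ v, v ∉ S → (lift v (ξ' v)).IsSpherical (cmLocalIntegralLevel L 3 H v))
    (hocc : cmOccursInDiscreteSpectrum L 3 H μ fun v => lift v (ξ v)) (hocc' : cmOccursInDiscreteSpectrum L 3 H μ fun v => lift v (ξ' v))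
    (ht : psiG (𝓗G := fun v => (heckeAlgebra ℂ ((cmDatum L 3 H).Local v) (cmLocalIntegralLevel L 3 H v))ᵐᵒᵖ) (bOp b) (evp GH KH ξ S hξ) = psiG (𝓗G := fun v => (heckeAlgebra ℂ ((cmDatum L 3 H).Local v) (cmLocalIntegralLevel L 3 H v))ᵐᵒᵖ) (bOp b) (evp GH KH ξ' S hξ'))
    (v : HeightOneSpectrum (𝓞 ↥(maximalRealSubfield L))) (hvS : v ∉ S) (hv : ∃ w : PlacesOver L v, IsCMField.complexConj L • w.1 ≠ w.1) :
    ξ v = ξ' v :=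
  hLiftInj v hvS hv (ξ v) (ξ' v) (hξ v hvS) (hξ' v hvS)
    (lift_eq_at_split_of_psiG_evp_eq L H hH hHd μ hS KH lift b h14L hdual ξ ξ' hξ hξ' hl hl' hocc hocc' ht v hv)

/-! ## §3 The dealer's phrasing with the `G`-side `π` explicit: «`π` determines `ξ` off `S` at the split places» -/

include hH hHd hS in
/-- **An occurring `π` with `t(π) = ψ_G(t(ξ))` IS the lift of `ξ` at the split places** (when `lift ∘ ξ` occurs): the pointwise identity `t(π)_v(T) = ψ_G(t(ξ))_v(op T)` (14L's
un-opped currency on the left, ★ p855449's on the right) and ★ `evp_lift_eq_psiG_evp` give `t(π) = t(lift ∘ ξ)`, and 14L gives `π_v = lift(ξ_v)` at every split `v` — the index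
condition «`ψ_G(t(π)) = t`» of (13.8.3) read as a constraint on `π_v`. [cite: Rogawski1990, §13.8 p. 218] [cite: Rogawski1990, Thm. 13.3.5 p. 202] -/
theorem eq_lift_at_split_of_evp_eq_psiG
    (h14L : ∀ (L : Type) [Field L] [NumberField L] [IsCMField L] (H : Matrix (Fin 3) (Fin 3) L)
      (_hH : (H.map (cmConjRingHom L))ᵀ = H) (_hHd : IsUnit H.det)
      (μ : Measure (adelicGroupData (↥(maximalRealSubfield L)) L (IsCMField.complexConj L) 3 H).automorphicQuotient)
      [(adelicGroupData (↥(maximalRealSubfield L)) L (IsCMField.complexConj L) 3 H).IsAutomorphicMeasure μ]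
      (S : Set (HeightOneSpectrum (𝓞 ↥(maximalRealSubfield L)))), S.Finite →
      ∀ (π π' : ∀ v : HeightOneSpectrum (𝓞 ↥(maximalRealSubfield L)), IrrClass ((cmDatum L 3 H).Local v))
        (hπ : ∀ v, v ∉ S → (π v).IsSpherical (cmLocalIntegralLevel L 3 H v))
        (hπ' : ∀ v, v ∉ S → (π' v).IsSpherical (cmLocalIntegralLevel L 3 H v)),
        cmOccursInDiscreteSpectrum L 3 H μ π → cmOccursInDiscreteSpectrum L 3 H μ π' →
        K2E1EvpOfAutomorphicClass.evpAtIntegralLevel L 3 H π S hπ = K2E1EvpOfAutomorphicClass.evpAtIntegralLevel L 3 H π' S hπ' →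
        ∀ v : HeightOneSpectrum (𝓞 ↥(maximalRealSubfield L)), (∃ w : PlacesOver L v, IsCMField.complexConj L • w.1 ≠ w.1) → π v = π' v)
    (hdual : IsXiHDual (fun v => (cmDatum L 3 H).Local v) GH (fun v => cmLocalIntegralLevel L 3 H v) KH lift b)
    (π : ∀ v : HeightOneSpectrum (𝓞 ↥(maximalRealSubfield L)), IrrClass ((cmDatum L 3 H).Local v))
    (hπ : ∀ v, v ∉ S → (π v).IsSpherical (cmLocalIntegralLevel L 3 H v)) (hoccπ : cmOccursInDiscreteSpectrum L 3 H μ π)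
    (ξ : ∀ v, IrrClass (GH v)) (hξ : ∀ v, v ∉ S → (ξ v).IsSpherical (KH v))
    (hl : ∀ v, v ∉ S → (lift v (ξ v)).IsSpherical (cmLocalIntegralLevel L 3 H v)) (hocc : cmOccursInDiscreteSpectrum L 3 H μ fun v => lift v (ξ v))
    (hπt : ∀ (v : {v : HeightOneSpectrum (𝓞 ↥(maximalRealSubfield L)) // v ∉ S}) (T : heckeAlgebra ℂ ((cmDatum L 3 H).Local v.1) (cmLocalIntegralLevel L 3 H v.1)),
      evpAtIntegralLevel L 3 H π S hπ v T = psiG (𝓗G := fun v => (heckeAlgebra ℂ ((cmDatum L 3 H).Local v) (cmLocalIntegralLevel L 3 H v))ᵐᵒᵖ) (bOp b) (evp GH KH ξ S hξ) v (MulOpposite.op T))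
    (v : HeightOneSpectrum (𝓞 ↥(maximalRealSubfield L))) (hv : ∃ w : PlacesOver L v, IsCMField.complexConj L • w.1 ≠ w.1) :
    π v = lift v (ξ v) := by
  have h1 := evp_lift_eq_psiG_evp hdual ξ hξ hl
  have hev : evpAtIntegralLevel L 3 H π S hπ = evpAtIntegralLevel L 3 H (fun v => lift v (ξ v)) S hl := by
    funext v'
    apply AlgHom.ext
    intro T
    rw [hπt, evpAtIntegralLevel, evpOfClass_apply_eq_evp, h1]
  exact h14L L H hH hHd μ S hS π (fun v => lift v (ξ v)) hπ hl hoccπ hocc hev v hv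

include hH hHd hS in
/-- **«`π` DETERMINES `ξ` OFF `S` AT THE SPLIT PLACES»** [Rogawski1990 Thm. 13.3.5 (c)-shape]: if the occurring `π` is the `ψ_G`-lift of `ξ` AND of `ξ′` (e.v.p. identities `hπt`, `hπt′`,
both `IsXiHDual`-witnessed at the integral level off the finite `S`, both lifted families occurring), then `ξ_v = ξ′_v` at every split `v ∉ S` — given the injectivity binder `hLiftInj`.
This is the `H`-side PIN behind (f) `FlathHHyp` ∕ «`ρ_v = St_H(ξ_v)`» of ★ `K2E1St1383LetterOfPinned1383`. [cite: Rogawski1990, Thm. 13.3.5 p. 202 and §13.5 pp. 204–206] [cite: Rogawski1990, §13.8 p. 218] -/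
theorem xi_eq_at_split_of_evp_eq_psiG
    (h14L : ∀ (L : Type) [Field L] [NumberField L] [IsCMField L] (H : Matrix (Fin 3) (Fin 3) L)
      (_hH : (H.map (cmConjRingHom L))ᵀ = H) (_hHd : IsUnit H.det)
      (μ : Measure (adelicGroupData (↥(maximalRealSubfield L)) L (IsCMField.complexConj L) 3 H).automorphicQuotient)
      [(adelicGroupData (↥(maximalRealSubfield L)) L (IsCMField.complexConj L) 3 H).IsAutomorphicMeasure μ]
      (S : Set (HeightOneSpectrum (𝓞 ↥(maximalRealSubfield L)))), S.Finite →
      ∀ (π π' : ∀ v : HeightOneSpectrum (𝓞 ↥(maximalRealSubfield L)), IrrClass ((cmDatum L 3 H).Local v))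
        (hπ : ∀ v, v ∉ S → (π v).IsSpherical (cmLocalIntegralLevel L 3 H v))
        (hπ' : ∀ v, v ∉ S → (π' v).IsSpherical (cmLocalIntegralLevel L 3 H v)),
        cmOccursInDiscreteSpectrum L 3 H μ π → cmOccursInDiscreteSpectrum L 3 H μ π' →
        K2E1EvpOfAutomorphicClass.evpAtIntegralLevel L 3 H π S hπ = K2E1EvpOfAutomorphicClass.evpAtIntegralLevel L 3 H π' S hπ' →
        ∀ v : HeightOneSpectrum (𝓞 ↥(maximalRealSubfield L)), (∃ w : PlacesOver L v, IsCMField.complexConj L • w.1 ≠ w.1) → π v = π' v)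
    (hLiftInj : ∀ v, v ∉ S → (∃ w : PlacesOver L v, IsCMField.complexConj L • w.1 ≠ w.1) →
      ∀ ρ₁ ρ₂ : IrrClass (GH v), ρ₁.IsSpherical (KH v) → ρ₂.IsSpherical (KH v) → lift v ρ₁ = lift v ρ₂ → ρ₁ = ρ₂)
    (hdual : IsXiHDual (fun v => (cmDatum L 3 H).Local v) GH (fun v => cmLocalIntegralLevel L 3 H v) KH lift b)
    (π : ∀ v : HeightOneSpectrum (𝓞 ↥(maximalRealSubfield L)), IrrClass ((cmDatum L 3 H).Local v))
    (hπ : ∀ v, v ∉ S → (π v).IsSpherical (cmLocalIntegralLevel L 3 H v)) (hoccπ : cmOccursInDiscreteSpectrum L 3 H μ π)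
    (ξ ξ' : ∀ v, IrrClass (GH v)) (hξ : ∀ v, v ∉ S → (ξ v).IsSpherical (KH v)) (hξ' : ∀ v, v ∉ S → (ξ' v).IsSpherical (KH v))
    (hl : ∀ v, v ∉ S → (lift v (ξ v)).IsSpherical (cmLocalIntegralLevel L 3 H v)) (hl' : ∀ v, v ∉ S → (lift v (ξ' v)).IsSpherical (cmLocalIntegralLevel L 3 H v))
    (hocc : cmOccursInDiscreteSpectrum L 3 H μ fun v => lift v (ξ v)) (hocc' : cmOccursInDiscreteSpectrum L 3 H μ fun v => lift v (ξ' v))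
    (hπt : ∀ (v : {v : HeightOneSpectrum (𝓞 ↥(maximalRealSubfield L)) // v ∉ S}) (T : heckeAlgebra ℂ ((cmDatum L 3 H).Local v.1) (cmLocalIntegralLevel L 3 H v.1)),
      evpAtIntegralLevel L 3 H π S hπ v T = psiG (𝓗G := fun v => (heckeAlgebra ℂ ((cmDatum L 3 H).Local v) (cmLocalIntegralLevel L 3 H v))ᵐᵒᵖ) (bOp b) (evp GH KH ξ S hξ) v (MulOpposite.op T))
    (hπt' : ∀ (v : {v : HeightOneSpectrum (𝓞 ↥(maximalRealSubfield L)) // v ∉ S}) (T : heckeAlgebra ℂ ((cmDatum L 3 H).Local v.1) (cmLocalIntegralLevel L 3 H v.1)),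
      evpAtIntegralLevel L 3 H π S hπ v T = psiG (𝓗G := fun v => (heckeAlgebra ℂ ((cmDatum L 3 H).Local v) (cmLocalIntegralLevel L 3 H v))ᵐᵒᵖ) (bOp b) (evp GH KH ξ' S hξ') v (MulOpposite.op T))
    (v : HeightOneSpectrum (𝓞 ↥(maximalRealSubfield L))) (hvS : v ∉ S) (hv : ∃ w : PlacesOver L v, IsCMField.complexConj L • w.1 ≠ w.1) :
    ξ v = ξ' v :=
  hLiftInj v hvS hv (ξ v) (ξ' v) (hξ v hvS) (hξ' v hvS)
    ((eq_lift_at_split_of_evp_eq_psiG L H hH hHd μ hS KH lift b h14L hdual π hπ hoccπ ξ hξ hl hocc hπt v hv).symm.trans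
      (eq_lift_at_split_of_evp_eq_psiG L H hH hHd μ hS KH lift b h14L hdual π hπ hoccπ ξ' hξ' hl' hocc' hπt' v hv))

end Summit.HodgeConjecture.HodgeConjecture.Cruxes.H413.K2E1XiHPinnedOffSplitPlaces

end
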